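import Literature.MathematicalPhysics.QuantumFieldTheory.Balaban1983to89.B9Eq373KatoPairedRemainder
import Literature.MathematicalPhysics.QuantumFieldTheory.Balaban1983to89.B9Eq331PureGaugeResolventConjugation
import Literature.MathematicalPhysics.QuantumFieldTheory.Balaban1983to89.B9Eq373TransporterLipschitzLetters

/-!
# `Balaban1983to89.B9Eq373KatoPairedRemainderPureGauge` — T. Bałaban, *Propagators for lattice gauge theories in a background field*, Commun. Math. Phys.
# **99** (1985) 389–434 [Balaban1985BackgroundPropagators] (3.23) p. 394, (3.28)–(3.31) p. 395, (3.35) p. 396, (3.70)–(3.73) pp. 404–405: **THE PAIRED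
# TWO-BACKGROUND REMAINDER OF THE COVARIANT SITE LAPLACIAN AT THE PAIR `(U⁰, U) = (1^g, V^g)` — A BACKGROUND AGAINST ITS PURE-GAUGE SKELETON — WITH EVERY
# TRANSPORTER LETTER DISCHARGED FROM GROUP-LEVEL DATA: for `g` fibrewise isometric, `V` unit-bounded with contracting transporters, `‖V(b) − 1‖ ≤ δ₀` and
# `‖V(x,μ) − V(x−e_μ,μ)‖ ≤ δ₁`:
# `‖(Δ_{U⁰}f)(x) − (Δ_Uf)(x)‖ ≤ |t|·(2M_φM_φ′δ₀)·Σ_μ(‖(∇_Uf)(x,μ)‖ + ‖(∇_Uf)(x−e_μ,μ)‖) + d·t²·(2M_φM_φ′δ₁ + (2M_φM_φ′δ₀)²)·‖f(x)‖`,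
# and, in the gauge (3.35) `V = e^{iηA}` with `‖A‖ ≤ r`, `‖A(x,μ) − A(x−e_μ,μ)‖ ≤ η·a′`: `δ₁ = η·(η·a′)·e^{ηr}` — so at `t = η⁻¹`, `δ₀ = O(η|A|)` every term is `η`-FREE:
# `O(|A|)·Σ‖∇_Uf‖ + d·(a′e^{ηr} + O(|A|²))·‖f(x)‖`, print's (3.73)** — the (PV) letter of storey J of the NE9 chain INSTANTIATED at its comparison pair

statement-level skeleton of published theorems with citation tags; proofs where landed; nothing here is a claim about the Yang–Mills mass gap

CITATION HEADER (lean-in-tree rule).  Audit cell `pub-balaban`, sub-cell `t4`, BINDER row NE9; filed by NE9 crux-team LEAF PROVER 05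
(`b2b-balaban-t4-ne9-formalise-leaf-05`, gen 83).  SOURCE READ first-hand in the held text layer [Balaban1985BackgroundPropagators]
(`paper:balaban1985-cmp99-background-propagators`, journal page = PDF page + 388): p. 404 *«Thus we have to investigate only an expansion of the operator
D*_{U′U}D_{U′U}»*, (3.70)–(3.71); p. 405 (3.73) *«|(V₁(A)A′)(b)| ≤ O(1)(|∇A||A′| + |A||∇A′| + |A|²|A′|) … The derivatives are, of course, the covariant derivatives
defined by U»*; p. 396 (3.35); p. 398 *«All these inequalities are invariant with respect to gauge transformations of U»*.  The lemma is the COMPOSITION of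
`B9Eq373KatoPairedRemainder.norm_equiv_covLaplaceSiteK_sub_le_paired` (the abstract paired remainder; t4-ne9-idea-1 g123 ∕ g131 mathematics) with the
transporter letters of `B9Eq331PureGaugeResolventConjugation` §6 and `B9Eq373TransporterLipschitzLetters` and `B9Eq384RemainderLetters` §4 — [folklore]
plumbing; nothing printed is a hypothesis except the fibrewise isometry `hAd` of the gauge and the contraction `hRV` of `R(V(b))` (unitarity; DERIVED for unitary
`g`, `V` in `B9Eq387CubeReductionGaugeBackground` §2 ∕ §4).

WHY THIS FILE (cell context).  Storey J (OWNER t4-ne9-p1 plan v11 §2 (ii); t4-ne9-idea-1 g121 §2 (PERT)) feeds the gradient-row bootstrap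
`B9Eq342GradientRowBootstrap.norm_le_of_gradient_row_bootstrap` with the perturbation `(Δ_U − Δ_{U⁰})(χu)` sized FIRST ORDER in the unknown `∇_U`-row
(coefficient `ε₁ ∝ a`) plus an `η`-free zeroth order (`ε₂ ∝ a′ + a²`).  This file is that sizing at the pair the chain uses (`U = Ũ^{g₀⁻¹}` on a cube,
`U⁰` its pure-gauge skeleton; `B9Eq331PureGaugeResolventConjugation` §5), with the pure gauge as FIRST datum so that the first order is in `∇_U`.

WHAT IS PROVED (sorry-free; 0 `def`; [folklore] composition).  Context: `φ : W ≃ₗ[ℂ] 𝔸` with `‖φw‖ ≤ M_φ‖w‖`, `‖φ⁻¹X‖ ≤ M_φ′‖X‖`, `0 ≤ M_φ, M_φ′`;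
`g : TSite d P → 𝔸ˣ` with `hAd`; `V : Bond d P → 𝔸ˣ` with `V(b) ∈ U1`, `‖R(V(b))w‖ ≤ ‖w‖`; `U⁰ := gaugeU g 1`, `U := gaugeU g V`; real `t`; `f ∈ SiteL2K`; a site `x`.
* §1 **`norm_adTransportW_inv_sub_self_le`** — `‖V(b) − 1‖ ≤ δ₀ ⟹ ‖R(V(b)⁻¹)w − w‖ ≤ 2M_φM_φ′δ₀‖w‖` (`B9Eq384RemainderLetters.norm_adTransportW_sub_le` at the
  inverse field, `B7Prop1Explicit.norm_inv_sub_one_le`).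
* §2 **`norm_covLaplace_pureGauge_sub_gaugeU_le_paired`** — THE LETTER displayed in the title, from `0 ≤ δ₀`, `‖V(b) − 1‖ ≤ δ₀` (all `b`) and
  `‖V(x,μ) − V(x−e_μ,μ)‖ ≤ δ₁` (all `μ`).
* §3 **`norm_covLaplace_pureGauge_sub_gaugeU_le_paired_exp`** — the same with `V(b) = e^{iηA(b)}` as group elements, `η ≥ 0`, `‖A(b)‖ ≤ r`,
  `‖A(x,μ) − A(x−e_μ,μ)‖ ≤ η·a′`: `δ₁ := η·(η·a′)·e^{ηr}` (`B9Eq373TransporterLipschitzLetters.norm_exp_smul_sub_exp_smul_le`).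
* §4 **`norm_covDeriv_gaugeU_sub_pureGauge_apply_le`** — the conversion letter `‖(∇_Uf)(b) − (∇_{U⁰}f)(b)‖ ≤ ‖c‖·(2M_φM_φ′δ₀)·‖f(b₊)‖` (storey J's `ε₀·N` slot).
HONEST SCOPE.  One site, one direction sum; the letters `δ₀`, `r`, `a′` are the CONSUMER's ((3.35) is a hypothesis of Thm 3.1; the tree's per-cube reduction
supplies `δ₀ = l1(n)·δ` from small plaquettes but NOT the gradient letter `a′`); the cutoff `χ`, the averaging penalty `a′Q′*Q′` and the bond operators of
(3.70)–(3.75) are not treated; nothing of Bałaban's asserted.  ONE instance of ONE letter of ONE un-opened storey (J) of row L13.  NOT summit progress (cell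
pub-balaban: NE9 NOT PRINTED ∕ NOT PROVED; «NE9 ⇐ the named binders»; row WALLED ON A MODEL (O-NE9-1; #5 UNRULED); spine PROVED 0∕9; rung (B)+1 finite T⁴ — NOT
infinite volume, NOT mass gap, NOT BetaPertH, NOT Clay).  HONEST DEPENDENCY (cell line): continuum YM on T⁴ ⇐ BetaPertH ∧ nine spine estimates (0/9 proved);
BetaPertH ⇐ (D1) ∧ (D4) ∧ CAP+tail; G-an2-4 gates asym, D1 and NE2/3/4.  NEW file; nothing modified.  Net new unproved facts: 0.
-/

noncomputable section

open scoped BigOperators InnerProductSpace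

namespace Literature.MathematicalPhysics.QuantumFieldTheory.Balaban1983to89.B9Eq373KatoPairedRemainderPureGauge

open B4Sect5Torus (TSite)
open B9SectCLatticeCarrier (Bond unshift)
open B9Eq311L2Pairing (WL2)
open B9Eq310HessianOperator (adTransportW)
open B11Eq103H1Complex (SiteL2K covLaplaceSiteK covDerivL2K)
open B9Eq328GaugeAction (gaugeU AdW)
open B7Prop1Explicit (U1 mem_U1 norm_inv_sub_one_le)
open B9Eq373KatoPairedRemainder (norm_equiv_covLaplaceSiteK_sub_le_paired)
open B9SectCLatticeCarrier (btgt)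
open B9Eq331PureGaugeResolventConjugation (adTransportW_inv_adTransportW norm_relTransporter_pureGauge_sub_le
  norm_adTransportW_pureGauge_inv_sub_gaugeU_inv_le norm_covDiff_relTransporter_pureGauge_le norm_adTransportW_pureGauge_inv norm_adTransportW_gaugeU_le
  norm_adTransportW_gaugeU_sub_pureGauge_le)
open B9Eq373TransporterLipschitzLetters (norm_adTransportW_inv_sub_adTransportW_inv_le norm_exp_smul_sub_exp_smul_le)

variable {d : ℕ} {Pd : Fin d → ℕ} {𝔸 : Type*} [NormedRing 𝔸] [NormedAlgebra ℂ 𝔸] [NormOneClass 𝔸]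
  {W : Type*} [NormedAddCommGroup W] [InnerProductSpace ℂ W] (φ : W ≃ₗ[ℂ] 𝔸) {Mφ Mφ' : ℝ}
  (hφ : ∀ w, ‖φ w‖ ≤ Mφ * ‖w‖) (hφ' : ∀ X, ‖φ.symm X‖ ≤ Mφ' * ‖X‖) (hMφ : 0 ≤ Mφ) (hMφ' : 0 ≤ Mφ')
  {c₀ : ℝ} [Fact (0 < c₀)] (g : TSite d Pd → 𝔸ˣ)
  (hAd : ∀ (x : TSite d Pd) (v v' : W), ⟪AdW φ (g x) v, AdW φ (g x) v'⟫_ℂ = ⟪v, v'⟫_ℂ)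
  (V : Bond d Pd → 𝔸ˣ) (hV1 : ∀ b, V b ∈ U1 𝔸) (hRV : ∀ (b : Bond d Pd) (w : W), ‖adTransportW φ V b w‖ ≤ ‖w‖)

/-! ## §1 The `hV′` letter from the group-level smallness `‖V(b) − 1‖ ≤ δ₀` -/

include hφ hφ' hMφ' hV1 in
/-- **`‖R(V(b)⁻¹)w − w‖ ≤ 2M_φM_φ′·δ₀·‖w‖` WHEN `‖V(b) − 1‖ ≤ δ₀`** and `V(b) ∈ U1` (`‖V(b)⁻¹ − 1‖ ≤ ‖V(b) − 1‖`). [folklore]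
[cite: Balaban1985BackgroundPropagators, (3.70) p.404, (3.8) p.392] -/
theorem norm_adTransportW_inv_sub_self_le (b : Bond d Pd) {δ₀ : ℝ} (hδ₀ : ‖(V b : 𝔸) - 1‖ ≤ δ₀) (w : W) :
    ‖adTransportW φ (fun b => (V b)⁻¹) b w - w‖ ≤ 2 * Mφ * Mφ' * δ₀ * ‖w‖ :=
  B9Eq384RemainderLetters.norm_adTransportW_sub_le φ hφ hφ' hMφ' (fun b => (V b)⁻¹) b (Subgroup.inv_mem _ (hV1 b))
    ((norm_inv_sub_one_le (hV1 b)).trans hδ₀) w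

/-! ## §2 The paired remainder at the pair `(1^g, V^g)` -/

include hφ hφ' hMφ hMφ' hAd hV1 hRV in
/-- **THE PAIRED TWO-BACKGROUND REMAINDER AT `(U⁰, U) = (1^g, V^g)`.**  For `g` fibrewise isometric (`hAd`), `V` with `V(b) ∈ U1`, contracting `R(V(b))`,
`‖V(b) − 1‖ ≤ δ₀` for all bonds and `‖V(x,μ) − V(x−e_μ,μ)‖ ≤ δ₁` for all directions at the site `x`:
`‖(Δ_{U⁰}f)(x) − (Δ_Uf)(x)‖ ≤ |t|·(2M_φM_φ′δ₀)·Σ_μ(‖(∇_Uf)(x,μ)‖ + ‖(∇_Uf)(x−e_μ,μ)‖) + d·(t²(2M_φM_φ′δ₁ + (2M_φM_φ′δ₀)²))·‖f(x)‖` — FIRST ORDER in the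
`U`-covariant gradient, the zeroth order carrying the consecutive-difference letter `δ₁` and `δ₀²` only.
Proof: `B9Eq373KatoPairedRemainder.norm_equiv_covLaplaceSiteK_sub_le_paired` with the six transporter binders of `B9Eq331PureGaugeResolventConjugation` §6,
`hV′` from §1, `hdV′` from `B9Eq373TransporterLipschitzLetters.norm_adTransportW_inv_sub_adTransportW_inv_le`. [folklore]
[cite: Balaban1985BackgroundPropagators, (3.23) p.394, (3.70)–(3.71) p.404, (3.73) p.405, (3.28)–(3.31) p.395] -/
theorem norm_covLaplace_pureGauge_sub_gaugeU_le_paired (t : ℝ) (f : SiteL2K ℂ d Pd c₀ W) (x : TSite d Pd) {δ₀ δ₁ : ℝ} (hδ : 0 ≤ δ₀)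
    (hδ₀ : ∀ b, ‖(V b : 𝔸) - 1‖ ≤ δ₀) (hδ₁ : ∀ μ, ‖(V (x, μ) : 𝔸) - (V (unshift μ x, μ) : 𝔸)‖ ≤ δ₁) :
    ‖WL2.equiv ℂ _ W (covLaplaceSiteK (t : ℂ) (adTransportW φ (gaugeU g 1)) (adTransportW φ fun b => (gaugeU g 1 b)⁻¹) f) x -
        WL2.equiv ℂ _ W (covLaplaceSiteK (t : ℂ) (adTransportW φ (gaugeU g V)) (adTransportW φ fun b => (gaugeU g V b)⁻¹) f) x‖ ≤
      |t| * (2 * Mφ * Mφ' * δ₀) *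
          ∑ μ, (‖WL2.equiv ℂ _ W (covDerivL2K ℂ c₀ (t : ℂ) (adTransportW φ (gaugeU g V)) f) (x, μ)‖ +
            ‖WL2.equiv ℂ _ W (covDerivL2K ℂ c₀ (t : ℂ) (adTransportW φ (gaugeU g V)) f) (unshift μ x, μ)‖) +
        d * (t ^ 2 * (2 * Mφ * Mφ' * δ₁ + (2 * Mφ * Mφ' * δ₀) * (2 * Mφ * Mφ' * δ₀))) * ‖WL2.equiv ℂ _ W f x‖ := by
  have h2 : 0 ≤ 2 * Mφ * Mφ' := by positivity
  have hV' : ∀ (b : Bond d Pd) (w : W), ‖adTransportW φ (fun b => (V b)⁻¹) b w - w‖ ≤ 2 * Mφ * Mφ' * δ₀ * ‖w‖ :=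
    fun b w => norm_adTransportW_inv_sub_self_le φ hφ hφ' hMφ' V hV1 b (hδ₀ b) w
  have hdV' : ∀ (μ : Fin d) (w : W), ‖adTransportW φ (fun b => (V b)⁻¹) (x, μ) w - adTransportW φ (fun b => (V b)⁻¹) (unshift μ x, μ) w‖ ≤
      2 * Mφ * Mφ' * δ₁ * ‖w‖ := fun μ w =>
    (norm_adTransportW_inv_sub_adTransportW_inv_le φ hφ hφ' hMφ' V V (x, μ) (unshift μ x, μ) (hV1 _) (hV1 _) w).trans
      (mul_le_mul_of_nonneg_right (mul_le_mul_of_nonneg_left (hδ₁ μ) h2) (norm_nonneg w))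
  exact norm_equiv_covLaplaceSiteK_sub_le_paired (𝕜 := ℂ) t (adTransportW φ (gaugeU g 1)) (adTransportW φ fun b => (gaugeU g 1 b)⁻¹)
    (adTransportW φ (gaugeU g V)) (adTransportW φ fun b => (gaugeU g V b)⁻¹) (adTransportW_inv_adTransportW φ (gaugeU g 1))
    (adTransportW_inv_adTransportW φ (gaugeU g V)) f x (mul_nonneg h2 hδ)
    (fun μ u => norm_relTransporter_pureGauge_sub_le φ g V hAd (x, μ) (hV' (x, μ)) u)
    (fun μ u => norm_relTransporter_pureGauge_sub_le φ g V hAd (unshift μ x, μ) (hV' (unshift μ x, μ)) u)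
    (fun μ u => norm_adTransportW_pureGauge_inv_sub_gaugeU_inv_le φ g V hAd (unshift μ x, μ) (hV' (unshift μ x, μ)) u)
    (fun μ u => norm_covDiff_relTransporter_pureGauge_le φ g V hAd x μ (hdV' μ) u)
    (fun μ u => (norm_adTransportW_pureGauge_inv φ g hAd (unshift μ x, μ) u).le)
    (fun μ u => norm_adTransportW_gaugeU_le φ g V hAd (unshift μ x, μ) (hRV (unshift μ x, μ)) u)

/-! ## §3 The same in the gauge (3.35): `V = e^{iηA}` with a flat-gradient letter on `A` -/

include hφ hφ' hMφ hMφ' hAd hV1 hRV in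
/-- **THE PAIRED REMAINDER AT `(1^g, V^g)` FOR `V = e^{iηA}`**: `𝔸` complete, `η ≥ 0`, `V(b) = e^{iηA(b)}` as group elements, `‖A(b)‖ ≤ r`,
`‖V(b) − 1‖ ≤ δ₀` (`0 ≤ δ₀`) and the FLAT GRADIENT LETTER `‖A(x,μ) − A(x−e_μ,μ)‖ ≤ η·a′` at `x` ⊢ §2 with `δ₁ = η·(η·a′)·e^{ηr}`.  Print's units: `t = η⁻¹`,
`δ₀ = O(η|A|)`, so the bound reads `O(|A|)·Σ‖∇_Uf‖ + d·(a′e^{ηr} + O(|A|²))·‖f(x)‖` — (3.73) with every `η` cancelled. [folklore]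
[cite: Balaban1985BackgroundPropagators, (3.73) p.405, (3.35) p.396, (3.70) p.404] -/
theorem norm_covLaplace_pureGauge_sub_gaugeU_le_paired_exp [CompleteSpace 𝔸] (t : ℝ) (f : SiteL2K ℂ d Pd c₀ W) (x : TSite d Pd)
    {η r a' δ₀ : ℝ} (hη : 0 ≤ η) (A : Bond d Pd → 𝔸) (hVA : ∀ b, (V b : 𝔸) = NormedSpace.exp ((Complex.I * η : ℂ) • A b))
    (hA : ∀ b, ‖A b‖ ≤ r) (hδ : 0 ≤ δ₀) (hδ₀ : ∀ b, ‖(V b : 𝔸) - 1‖ ≤ δ₀) (hdA : ∀ μ, ‖A (x, μ) - A (unshift μ x, μ)‖ ≤ η * a') :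
    ‖WL2.equiv ℂ _ W (covLaplaceSiteK (t : ℂ) (adTransportW φ (gaugeU g 1)) (adTransportW φ fun b => (gaugeU g 1 b)⁻¹) f) x -
        WL2.equiv ℂ _ W (covLaplaceSiteK (t : ℂ) (adTransportW φ (gaugeU g V)) (adTransportW φ fun b => (gaugeU g V b)⁻¹) f) x‖ ≤
      |t| * (2 * Mφ * Mφ' * δ₀) *
          ∑ μ, (‖WL2.equiv ℂ _ W (covDerivL2K ℂ c₀ (t : ℂ) (adTransportW φ (gaugeU g V)) f) (x, μ)‖ +
            ‖WL2.equiv ℂ _ W (covDerivL2K ℂ c₀ (t : ℂ) (adTransportW φ (gaugeU g V)) f) (unshift μ x, μ)‖) +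
        d * (t ^ 2 * (2 * Mφ * Mφ' * (η * (η * a') * Real.exp (η * r)) + (2 * Mφ * Mφ' * δ₀) * (2 * Mφ * Mφ' * δ₀))) *
          ‖WL2.equiv ℂ _ W f x‖ :=
  norm_covLaplace_pureGauge_sub_gaugeU_le_paired φ hφ hφ' hMφ hMφ' g hAd V hV1 hRV t f x hδ hδ₀ fun μ => by
    rw [hVA, hVA]
    exact (norm_exp_smul_sub_exp_smul_le hη (hA _) (hA _)).trans
      (mul_le_mul_of_nonneg_right (mul_le_mul_of_nonneg_left (hdA μ) hη) (Real.exp_pos _).le)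

/-! ## §4 The conversion letter at the pair: `(∇_U − ∇_{U⁰})f` read at a bond is zeroth order in `f`, first order in `δ₀` -/

include hφ hφ' hMφ' hAd hV1 in
/-- **`‖(∇_Uf)(b) − (∇_{U⁰}f)(b)‖ ≤ ‖c‖·(2M_φM_φ′δ₀)·‖f(b₊)‖`** at the pair `(U⁰, U) = (1^g, V^g)` when `‖V(b) − 1‖ ≤ δ₀`, `V(b) ∈ U1`, `g` fibrewise
isometric: `(∇_Uf)(b) − (∇_{U⁰}f)(b) = c•(R(U(b)) − R(U⁰(b)))f(b₊)` and `B9Eq331PureGaugeResolventConjugation.norm_adTransportW_gaugeU_sub_pureGauge_le` with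
`hV` = `B9Eq384RemainderLetters.norm_adTransportW_sub_le`.  Storey J's `ε₀·N` slot (the unknown `∇_UG′` written through the comparison gradient `∇_{U⁰}G′`);
print's units `c = η⁻¹`, `δ₀ = O(η|A|)`: `O(|A|)·‖f(b₊)‖`, `η`-free. [folklore] [cite: Balaban1985BackgroundPropagators, (3.3) p.391, (3.70) p.404, (3.73) p.405] -/
theorem norm_covDeriv_gaugeU_sub_pureGauge_apply_le (c : ℂ) (f : SiteL2K ℂ d Pd c₀ W) (b : Bond d Pd) {δ₀ : ℝ} (hδ₀ : ‖(V b : 𝔸) - 1‖ ≤ δ₀) :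
    ‖WL2.equiv ℂ _ W (covDerivL2K ℂ c₀ c (adTransportW φ (gaugeU g V)) f) b -
        WL2.equiv ℂ _ W (covDerivL2K ℂ c₀ c (adTransportW φ (gaugeU g 1)) f) b‖ ≤
      ‖c‖ * (2 * Mφ * Mφ' * δ₀) * ‖WL2.equiv ℂ _ W f (btgt b)‖ := by
  rw [B11Eq103H1Complex.equiv_covDerivL2K, B11Eq103H1Complex.equiv_covDerivL2K, B9Eq33CovDerivVector.covDeriv_apply,
    B9Eq33CovDerivVector.covDeriv_apply, ← smul_sub, sub_sub_sub_cancel_right, norm_smul, mul_assoc]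
  exact mul_le_mul_of_nonneg_left (norm_adTransportW_gaugeU_sub_pureGauge_le φ g V hAd b
    (B9Eq384RemainderLetters.norm_adTransportW_sub_le φ hφ hφ' hMφ' V b (hV1 b) hδ₀) _) (norm_nonneg c)

end Literature.MathematicalPhysics.QuantumFieldTheory.Balaban1983to89.B9Eq373KatoPairedRemainderPureGauge

end
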